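import Literature.Probability.RandomPlanarGeometry.SAWCountMonotoneOdd
import Literature.Probability.RandomPlanarGeometry.SAWCountMonotoneOpenEnds
import Literature.Probability.RandomPlanarGeometry.SAWIrreducibleBridgeSpanOne
import HarnessLib

/-!
# Strict monotonicity `cₙ < cₙ₊₁` on `ℤ^d` (`d ≥ 2`) wherever the doubly trapped walks are absent: all
# `n ≤ 6d - 4` and every even `n ≤ 8d - 8`

Sequel of `SAWCountMonotoneReversal.lean` (the weighted pairing lemma
`card_not_doublyTrapped_add_sum_le_count_succ`: the walks outside `T₂` plus any weight `w` with
`w ω' + 2 ≤ extCount ω' n` number at most `cₙ₊₁`), `SAWCountMonotoneEven.lean` / `SAWCountMonotoneOdd.lean`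
(`T₂ = doublyTrapped d n = ∅` for even `n ≤ 8d - 8` / odd `n ≤ 6d - 5`) and `SAWCountMonotoneOpenEnds.lean`
(`extCount_eq_of_strictTop`: a strict top has `2d - 1` free extensions).  Putting weight `1` on the straight
walk `i ↦ i e₀` (a strict top in coordinate `0`, so `2d - 1 ≥ 3` free extensions when `d ≥ 2`) gives one
spare unit, hence STRICT inequality:

* `count_lt_count_succ_of_doublyTrapped_eq_empty` : `d ≥ 2`, `n ≥ 1`, `T₂ = ∅` ⇒ `cₙ < cₙ₊₁`;
* `count_lt_count_succ_of_le_six_mul` : **`cₙ < cₙ₊₁` for every `d ≥ 2` and all `n ≤ 6d - 4`**;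
* `count_lt_count_succ_of_even` : `cₙ < cₙ₊₁` for every `d ≥ 2` and every even `n ≤ 8d - 8`.

(`d = 1` is excluded: there `cₙ = 2` for all `n ≥ 1`.)  The non-strict inequality for all `n` is
O'Brien's theorem, the tree's named fact `BDGS2012_count_mono`.
[cite: MadrasSlade1993, §1.1, §7.1] [cite: BDGS2012, §1.3 (`cₙ ≤ cₙ₊₁`, O'Brien 1990)]
-/

noncomputable section

open Literature.Probability.LatticeModels Literature.Probability.Percolation SimpleGraph
open scoped BigOperators

namespace Literature.Probability.RandomPlanarGeometry.SAW.Zd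

variable {d : ℕ}

/-- The straight walk has `2d - 1` free extensions (`n ≥ 1`): its endpoint is a strict top in coordinate
`0`. [cite: MadrasSlade1993, §1.1] -/
theorem extCount_straightWalk [NeZero d] {n : ℕ} (hn : 1 ≤ n) :
    extCount (straightWalk d n) n = 2 * d - 1 := by
  refine extCount_eq_of_strictTop (straightWalk_mem_saws d n) hn (k := 0) fun i hi => ?_
  simp only [straightWalk, Pi.single_eq_same, min_eq_left hi.le, le_refl, min_eq_left, Nat.cast_lt]
  exact hi

/-- **`cₙ < cₙ₊₁` when there is no doubly trapped walk** (`d ≥ 2`, `n ≥ 1`): the weighted pairing lemma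
with weight `1` on the straight walk, which has `2d - 1 ≥ 3` free extensions.
[cite: BDGS2012, §1.3] [cite: MadrasSlade1993, §7.1] -/
theorem count_lt_count_succ_of_doublyTrapped_eq_empty {n : ℕ} (hd : 2 ≤ d) (hn : 1 ≤ n)
    (hT : doublyTrapped d n = ∅) : count d n < count d (n + 1) := by
  classical
  haveI : NeZero d := ⟨by omega⟩
  have hstraight := straightWalk_mem_saws d n
  have h := card_not_doublyTrapped_add_sum_le_count_succ (d := d) n
    (fun ω' => if ω' = straightWalk d n then 1 else 0) (by
      intro ω' hω'
      by_cases h : ω' = straightWalk d n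
      · subst h
        refine Or.inr (Or.inl ?_)
        rw [if_pos rfl, extCount_straightWalk hn]
        omega
      · exact Or.inl (if_neg h))
  have hfilter : ((saws d n).filter fun ω => ¬ (extCount ω n = 0 ∧ extCount (revWalk n ω) n ≤ 1)) =
      saws d n := by
    refine Finset.filter_true_of_mem fun ω hω hcond => ?_
    have : ω ∈ doublyTrapped d n := mem_doublyTrapped.2 ⟨hω, hcond.1, hcond.2⟩
    rw [hT] at this
    exact Finset.notMem_empty ω this
  rw [hfilter, card_saws, Finset.sum_ite_eq' (saws d n) (straightWalk d n) (fun _ => 1),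
    if_pos hstraight] at h
  omega

/-- **`cₙ < cₙ₊₁` for every `d ≥ 2` and all `n ≤ 6d - 4`** (by `doublyTrapped_eq_empty_of_odd`,
`doublyTrapped_eq_empty_of_even`, and `c₀ = 1 < 2d = c₁`). [cite: BDGS2012, §1.3] -/
theorem count_lt_count_succ_of_le_six_mul {n : ℕ} (hd : 2 ≤ d) (hn : n + 4 ≤ 6 * d) :
    count d n < count d (n + 1) := by
  haveI : NeZero d := ⟨by omega⟩
  rcases Nat.eq_zero_or_pos n with rfl | hn1
  · rw [count_zero, Nat.zero_add, count_one_eq_two_mul]; omega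
  rcases Nat.even_or_odd n with hev | hodd
  · exact count_lt_count_succ_of_doublyTrapped_eq_empty hd hn1
      (doublyTrapped_eq_empty_of_even hev (by omega))
  · exact count_lt_count_succ_of_doublyTrapped_eq_empty hd hn1
      (doublyTrapped_eq_empty_of_odd hodd (by have := Nat.odd_iff.1 hodd; omega))

/-- **`cₙ < cₙ₊₁` for every `d ≥ 2` and every even `n ≤ 8d - 8`.** [cite: BDGS2012, §1.3] -/
theorem count_lt_count_succ_of_even {n : ℕ} (hd : 2 ≤ d) (hev : Even n) (hn : n + 7 ≤ 8 * d) :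
    count d n < count d (n + 1) := by
  haveI : NeZero d := ⟨by omega⟩
  rcases Nat.eq_zero_or_pos n with rfl | hn1
  · rw [count_zero, Nat.zero_add, count_one_eq_two_mul]; omega
  · exact count_lt_count_succ_of_doublyTrapped_eq_empty hd hn1 (doublyTrapped_eq_empty_of_even hev hn)

end Literature.Probability.RandomPlanarGeometry.SAW.Zd
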